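import Summits.BirchSwinnertonDyer.BirchSwinnertonDyer.Theorems.KatoDescentTamePotSupersingularTameLowerFouquetRoadBCS
import Summits.BirchSwinnertonDyer.BirchSwinnertonDyer.Theorems.KatoDescentTamePotSupersingularTameLowerSeedRecordTools
import HarnessLib

/-!
# Route `KatoDescentTamePotSupersingular` (rung K8-t′, cell `bsd-potss`): open core `TameLowerIntrinsicNonCM`
# (item stmt-BirchSwinnertonDyer-19618) — PER-ROW RECORDS 06 of the THIRD seed road `SeedRowC`
# (Fouquet 2025 Thm 4.1 (1)⇒(2) + Burungale–Castella–Skinner 2025 Thm 1.1.2 (b); NO `Ram`, rank or `L`-value condition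
# on the partner) on the CONTENT rows of the cell `L_{II*,5}` (a `--supports … --as helper` file; seat `bsd-potss-k8t-c2`, gen 9)

Rows in this file: `162400bu1` ← `6496e1`, `164300j1` ← `6572b1`, `172550b1` ← `6902c1`.

For each row `W` (Cremona's minimal model, `N_W = 25·N_G`, additive potentially supersingular TAME (t′) at `5`, Kodaira
`II*`, `v₅(c₄) = 4`; `r_an = 0`, `5 ∣ #Ш_an` — a CONTENT row of the 19618 census) and its congruent partner `G` at
`N_G = N_W/25` (plan g16 `UNITSEED-content-congruentG.tsv`: rank `2`, good ORDINARY at `5`, `ρ̄_{G,5}` onto), the record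
`tameLower_bcs_v<label>` is the SeedRowC road `Theorems.missingLowerBoundAt_rankZero_of_bcsSeed_of_prop4` (p484443)
instantiated: `MissingLowerBoundAt W 5` (L₀ = `ord₅ #Ш_an ≤ ord₅ #Ш`) from
* IN THE KERNEL (`decide` on Cremona's coefficients, tools `Theorems.KTSeedRec.*`): `Δ ≠ 0` and global minimality of
  `W` and `G` (Kraus, factored form; stated as the four theorems `isElliptic_…` / `isGloballyMinimal_…` and taken by the
  record as instance binders); `ρ̄_{W,5}`, `ρ̄_{G,5}` onto (three Serre Prop. 19 witnesses each,
  `Supersingular.surj_of_ainvs_of_serreWitnesses`); `GoodOrd G 5` (`5 ∤ Δ_G`, point count); `FouquetLevelCompatibleAt 5 W G`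
  and `Fouquet2025.Assumption34TateAt 5 W` from the kernel factorisation of `Δ`; Fouquet's Ass. 2.9 (2) EXACTLY
  (`FouquetGenericAt 5 W`: `ΨSq_5` has no root in `ℚ_5`) by two Hensel root censuses of x10b's `RootCensusNewton.check₄`;
* NAMED PUBLISHED INPUTS in hypothesis position: (A′) `Fouquet2025.padicValRat_bsd_rank_zero_of_congruence_of_seedMainIdentity`
  (`hA`), `burungale_castella_skinner_charIdeal_eq_padicLFunction_integral` (`hBCS`), modularity `exists_isNewformOf`
  (`hmodN`), GZK (`hGZK`), Kraus–Oesterlé 1992 Prop. 4 `KrausOesterle1992.prop4_torsionIso_of_congruences` (`hKO`);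
* EVIDENCE binders per row: `r_an(W) = 0` (`hr`, Cremona) and the FINITE Kraus–Oesterlé trace list `hlist` (all primes
  `ℓ < μ(M)/6`: `a_ℓ(W) ≡ a_ℓ(G) (mod 5)` off `N_W N_G`, `a_ℓ a'_ℓ ≡ ℓ + 1` at `ℓ ∥ N_W N_G`) — kit j265271/j265273/j265274/j265275 (tag bsd),
  engines VERBATIM from kt-pdesc g2 (j261046; reused by this seat's g8 j262735): A = `scan.gp` (PARI/GP, sha16
  d3ab08156e6bffa3: mod-5 screen of EVERY Cremona curve at `N_G`, K–O Prop. 4 verbatim on each survivor), B = `engineB.py`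
  (sha16 8f806e99f286370b, PARI-free point counts) re-deriving the verdict; per-pair modulus / bound / prime count in each
  docstring and in `HOME/k8t-c2/g9/SEEDROWC-CENSUS.tsv`.
TIER per row (docstring): `a₅(G)² ≢ 1 (mod 5)` = preprint-free chain (Fouquet Thm 2.10 via Nakamura 2023); `≡ 1` = flag
`@Fouquet-2.10-via-ColmezWang-PRE` (the census' tier B). HONEST LABEL: per-row instances of `SeedRowC`, CONDITIONAL on the
named published inputs; the class-wide statement (Kato's Conj. 12.10 lower inclusion at an additive potentially
supersingular prime) and the items 19618 / 19981 stay OPEN; nothing is booked; BSD is not proved for any curve here.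

References: [Fouquet2025EquivariantTNC] Thm 4.1, Thm 1.7 (2), Ass. 2.9, Ass. 3.4; [BurungaleCastellaSkinner2025] Thm 1.1.2 (b);
[KrausOesterle1992] Prop. 4; [Serre1972] §2.8 Prop. 19; [Kraus1989]; [SilvermanAEC2009] VII.1, VII.5 Prop. 5.1, Ex. 3.7;
[Cremona1997] Table 1; [Miller2011LMS] Def. 1.1.
-/

set_option autoImplicit false
-- sibling precedent (`KatoDescentTamePotSupersingularTameLowerFouquetRoadBCS.lean`): the directory name repeats the summit name
set_option linter.dupNamespace false

noncomputable section

open scoped Classical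

open WeierstrassCurve Literature.NumberTheory.EllipticCurves
  Literature.NumberTheory.EllipticCurves.ModularForms
  Literature.NumberTheory.EllipticCurves.Rank1Residual
  Literature.NumberTheory.EllipticCurves.Rank1Residual.Typed
  Literature.NumberTheory.EllipticCurves.Rank1Residual.X11RankOneCertificates
  Summit.BirchSwinnertonDyer.BirchSwinnertonDyer.Rank1Residual.IntModel
  Summit.BirchSwinnertonDyer.BirchSwinnertonDyer.Rank1Residual.X11RankOne
  Summit.BirchSwinnertonDyer.Rank1Residual.X11b
  Summit.BirchSwinnertonDyer.Rank1Residual.Supersingular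
  Summit.BirchSwinnertonDyer.Rank1Residual.Supersingular.RootCensusNewton
  Summit.BirchSwinnertonDyer.Rank1Residual.Supersingular.LocalOddTorsion
  Summit.BirchSwinnertonDyer.BirchSwinnertonDyer.Theorems

namespace Summit.BirchSwinnertonDyer.BirchSwinnertonDyer.Theorems.KTSeedRowC

/-- `162400bu1` = `[0, 0, 0, -2095000, -1167150000]` (Cremona) has `Δ ≠ 0`. [cite: Cremona1997, Table 1 (label 162400bu1)] -/
theorem isElliptic_v162400bu1 : (⟨0, 0, 0, -2095000, -1167150000⟩ : WeierstrassCurve ℚ).IsElliptic :=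
  isElliptic_of_discOf_ne_zero 0 0 0 (-2095000) (-1167150000) (by decide +kernel)

-- `decide` evaluates `discOf`/`c4Of`/`c6Of` and the Kraus tests on the literal coefficients
set_option maxRecDepth 100000 in
/-- `162400bu1` = `[0, 0, 0, -2095000, -1167150000]` (Cremona) is globally minimal — Kraus' criterion, factored form `|Δ| = 2^12 · 5^10 · 7 · 29^3`, in the kernel.
[cite: Kraus1989, Prop. 1 and Prop. 2] [cite: SilvermanAEC2009, VII.1 Remark 1.1] [cite: Cremona1997, Table 1 (label 162400bu1)] -/
theorem isGloballyMinimal_v162400bu1 : (⟨0, 0, 0, -2095000, -1167150000⟩ : WeierstrassCurve ℚ).IsGloballyMinimal :=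
  isGloballyMinimal_of_krausCriterion₃_factored 0 0 0 (-2095000) (-1167150000) [(2, 12), (5, 10), (7, 1), (29, 3)] (by decide +kernel)
    (by intro qe hqe; fin_cases hqe <;> norm_num) (by decide +kernel)

/-- `6496e1` = `[0, 0, 0, -17, 40]` (Cremona) has `Δ ≠ 0`. [cite: Cremona1997, Table 1 (label 6496e1)] -/
theorem isElliptic_c6496e1 : (⟨0, 0, 0, -17, 40⟩ : WeierstrassCurve ℚ).IsElliptic :=
  isElliptic_of_discOf_ne_zero 0 0 0 (-17) 40 (by decide +kernel)

-- `decide` evaluates `discOf`/`c4Of`/`c6Of` and the Kraus tests on the literal coefficients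
set_option maxRecDepth 100000 in
/-- `6496e1` = `[0, 0, 0, -17, 40]` (Cremona) is globally minimal — Kraus' criterion, factored form `|Δ| = 2^6 · 7 · 29^2`, in the kernel.
[cite: Kraus1989, Prop. 1 and Prop. 2] [cite: SilvermanAEC2009, VII.1 Remark 1.1] [cite: Cremona1997, Table 1 (label 6496e1)] -/
theorem isGloballyMinimal_c6496e1 : (⟨0, 0, 0, -17, 40⟩ : WeierstrassCurve ℚ).IsGloballyMinimal :=
  isGloballyMinimal_of_krausCriterion₃_factored 0 0 0 (-17) 40 [(2, 6), (7, 1), (29, 2)] (by decide +kernel)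
    (by intro qe hqe; fin_cases hqe <;> norm_num) (by decide +kernel)

-- `decide` evaluates the schema point counts, the supports and the two root censuses on the literal coefficients
set_option maxRecDepth 100000 in
/-- **L₀ = `ord_5 #Ш_an ≤ ord_5 #Ш` for `162400bu1`** (Cremona's minimal model `[0, 0, 0, -2095000, -1167150000]`, `N = 162400 = 25·6496`; additive
potentially supersingular TAME (t′) at `5`, Kodaira `II*` with `v₅(c₄) = 4` (cell `L_{II*,5}`); `r_an = 0`, `#Ш_an = 25` (`ord₅ = 2`),
`∏ c_ℓ = 2`, `#E(ℚ)_tors = 1`; census verdict `SEED-strict` tier B)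
**by the SeedRowC road from the partner `6496e1`** `[0, 0, 0, -17, 40]` (rank `2`, good ORDINARY at `5`: `#G̃(𝔽₅) = 10`, `a₅ = -4`
— `a₅² ≡ 1 (mod 5)`: the Fouquet Thm 2.10 input is the Colmez–Wang PREPRINT on this row, flag `@Fouquet-2.10-via-ColmezWang-PRE`; `ρ̄_{G,5}` onto).
IN THE KERNEL: `Δ ≠ 0` and global minimality of both equations (Kraus, factored form: `|Δ_W| = 2^12 · 5^10 · 7 · 29^3`,
`|Δ_G| = 2^6 · 7 · 29^2`); `ρ̄_{W,5}` and `ρ̄_{G,5}` onto by Serre Prop. 19 witnesses at `ℓ = 13, 11, 43`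
(`#W̃ = 18, 6, 36`; `#G̃ = 18, 16, 56`); `GoodOrd G 5`; strict level compatibility (every prime of `Δ_G`
divides `Δ_W` or is `5`); Ass. 3.4 in Tate form for `W` (no multiplicative prime q with 5 ∣ v_q(Δ_min): vacuous); Ass. 2.9 (2) EXACTLY (`ΨSq_5`
rootless in `ℚ_5`) by the two Hensel root censuses `check₄ 5 prePsi5Z 2 [] ∧ check₄ 5 prePsi5Z.reverse 1 []`.
BINDERS: named facts (A′) `hA`, BCS Thm 1.1.2 (b) `hBCS`, modularity `hmodN`, GZK `hGZK`, Kraus–Oesterlé Prop. 4 `hKO`; the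
instances (proved below as `isElliptic_…` / `isGloballyMinimal_…`); Cremona's `r_an = 0` (`hr`); the FINITE K–O trace list `hlist`
(kit j265275, engines A = PARI `scan.gp` / B = `engineB.py` of kt-pdesc g2 VERBATIM: K–O modulus `M = 162400`, `S = []`, `μ(M) = 345600`, bound `ℓ ≤ 57599`: 5835 primes, engine A PASS = engine B PASS (PASS 57599 5835)). Per-row instance of `SeedRowC`; the
class-wide statement and the items stay OPEN; nothing booked; BSD is not proved for this curve by this file.
[cite: Fouquet2025EquivariantTNC, Thm 4.1 (1)⇒(2) (pp. 24–25), Ass. 2.9 (p. 15), Ass. 3.4 (pp. 22–23)] [cite: BurungaleCastellaSkinner2025, Thm 1.1.2 (b)]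
[cite: KrausOesterle1992, Prop. 4] [cite: Serre1972, §2.8 Prop. 19] [cite: Cremona1997, Table 1 (labels 162400bu1, 6496e1)] [cite: Miller2011LMS, Def. 1.1] -/
theorem tameLower_bcs_v162400bu1
    (hA : Fouquet2025.padicValRat_bsd_rank_zero_of_congruence_of_seedMainIdentity)
    (hBCS : burungale_castella_skinner_charIdeal_eq_padicLFunction_integral) (hmodN : exists_isNewformOf)
    (hGZK : rank_eq_analyticRank_of_analyticRank_le_one) (hKO : KrausOesterle1992.prop4_torsionIso_of_congruences)
    (W G : WeierstrassCurve ℚ) [W.IsElliptic] [W.IsGloballyMinimal] [G.IsElliptic] [G.IsGloballyMinimal]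
    (hW : W = ⟨0, 0, 0, -2095000, -1167150000⟩) (hG : G = ⟨0, 0, 0, -17, 40⟩) (hr : W.analyticRank = 0)
    (hlist : ∀ (ℓ : ℕ) [Fact ℓ.Prime],
      6 * ℓ < KrausOesterle1992.gammaZeroIndex (KrausOesterle1992.modulus W G) →
      (padicValNat ℓ (W.conductorNorm ℤ * G.conductorNorm ℤ) = 0 →
          (5 : ℤ) ∣ W.frobeniusTrace ℓ - G.frobeniusTrace ℓ) ∧
        (padicValNat ℓ (W.conductorNorm ℤ * G.conductorNorm ℤ) = 1 →
          (5 : ℤ) ∣ W.frobeniusTrace ℓ * G.frobeniusTrace ℓ - (ℓ + 1))) :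
    MissingLowerBoundAt W 5 := by
  subst hW hG
  have hminW : (⟨0, 0, 0, -2095000, -1167150000⟩ : WeierstrassCurve ℚ).IsGloballyMinimal := inferInstance
  have hminG : (⟨0, 0, 0, -17, 40⟩ : WeierstrassCurve ℚ).IsGloballyMinimal := inferInstance
  have hIW : integralModelInt (⟨0, 0, 0, -2095000, -1167150000⟩ : WeierstrassCurve ℚ) = (⟨0, 0, 0, -2095000, -1167150000⟩ : WeierstrassCurve ℤ) :=
    integralModelInt_eq_of_map_eq _ (map_mk_int 0 0 0 (-2095000) (-1167150000))
  have hIG : integralModelInt (⟨0, 0, 0, -17, 40⟩ : WeierstrassCurve ℚ) = (⟨0, 0, 0, -17, 40⟩ : WeierstrassCurve ℤ) :=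
    integralModelInt_eq_of_map_eq _ (map_mk_int 0 0 0 (-17) 40)
  have hsurjW : Surj (⟨0, 0, 0, -2095000, -1167150000⟩ : WeierstrassCurve ℚ) 5 :=
    @surj_of_ainvs_of_serreWitnesses 0 0 0 (-2095000) (-1167150000) 5 ⟨by norm_num⟩ (by norm_num) hminW
      13 11 43 (by norm_num) (by norm_num) (by norm_num) (by decide) (by decide) (by decide)
      (by decide) (by decide) (by decide) (by decide +kernel) (by decide +kernel) (by decide +kernel)
      (n₁ := 18) (n₂ := 6) (n₃ := 36) (by decide +kernel) (by decide +kernel) (by decide +kernel)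
      (2 : ZMod 5) (3 : ZMod 5) (by decide +kernel) (by decide +kernel) (by decide +kernel)
  have hsurjG : Surj (⟨0, 0, 0, -17, 40⟩ : WeierstrassCurve ℚ) 5 :=
    @surj_of_ainvs_of_serreWitnesses 0 0 0 (-17) 40 5 ⟨by norm_num⟩ (by norm_num) hminG
      13 11 43 (by norm_num) (by norm_num) (by norm_num) (by decide) (by decide) (by decide)
      (by decide) (by decide) (by decide) (by decide +kernel) (by decide +kernel) (by decide +kernel)
      (n₁ := 18) (n₂ := 16) (n₃ := 56) (by decide +kernel) (by decide +kernel) (by decide +kernel)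
      (2 : ZMod 5) (3 : ZMod 5) (by decide +kernel) (by decide +kernel) (by decide +kernel)
  have hordG : GoodOrd (⟨0, 0, 0, -17, 40⟩ : WeierstrassCurve ℚ) 5 :=
    @KTSeedRec.goodOrd_of_countPoints 0 0 0 (-17) 40 5 ⟨by norm_num⟩ (by norm_num) hminG (by decide +kernel) 10
      (by decide +kernel) (by decide)
  have hlev : FouquetLevelCompatibleAt 5 (⟨0, 0, 0, -2095000, -1167150000⟩ : WeierstrassCurve ℚ) (⟨0, 0, 0, -17, 40⟩ : WeierstrassCurve ℚ) :=
    @KTSeedRec.fouquetLevelCompatibleAt_of_factorList 5 ⟨by norm_num⟩ _ _ _ _ _ _ _ _ hIW hIG [(2, 6), (7, 1), (29, 2)]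
      (by intro qe hqe; fin_cases hqe <;> norm_num) (by rw [intCurve_Δ]; decide +kernel)
      (by simp only [intCurve_Δ]; decide +kernel)
  have h34 : Fouquet2025.Assumption34TateAt 5 (⟨0, 0, 0, -2095000, -1167150000⟩ : WeierstrassCurve ℚ) :=
    KTSeedRec.assumption34TateAt_of_factorList 5 hIW [(2, 12), (5, 10), (7, 1), (29, 3)]
      (by intro qe hqe; fin_cases hqe <;> norm_num) (by rw [intCurve_Δ]; decide +kernel)
      (by simp only [intCurve_Δ, intCurve_c₄]; decide +kernel)
  have hgen := KTSeedRec.fouquetGenericAt_five_of_rootCensus 0 0 0 (-2095000) (-1167150000) 2 1 (by decide +kernel)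
    (by decide +kernel)
  haveI : Fact (Nat.Prime 5) := ⟨by norm_num⟩
  exact missingLowerBoundAt_rankZero_of_bcsSeed_of_prop4 _ _ 5 hA hBCS hmodN hGZK hKO (by norm_num) hr hsurjW hgen h34
    hordG hsurjG hlev hlist

/-- `164300j1` = `[0, 0, 0, -55000, -5021875]` (Cremona) has `Δ ≠ 0`. [cite: Cremona1997, Table 1 (label 164300j1)] -/
theorem isElliptic_v164300j1 : (⟨0, 0, 0, -55000, -5021875⟩ : WeierstrassCurve ℚ).IsElliptic :=
  isElliptic_of_discOf_ne_zero 0 0 0 (-55000) (-5021875) (by decide +kernel)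

-- `decide` evaluates `discOf`/`c4Of`/`c6Of` and the Kraus tests on the literal coefficients
set_option maxRecDepth 100000 in
/-- `164300j1` = `[0, 0, 0, -55000, -5021875]` (Cremona) is globally minimal — Kraus' criterion, factored form `|Δ| = 2^4 · 5^10 · 31^3 · 53`, in the kernel.
[cite: Kraus1989, Prop. 1 and Prop. 2] [cite: SilvermanAEC2009, VII.1 Remark 1.1] [cite: Cremona1997, Table 1 (label 164300j1)] -/
theorem isGloballyMinimal_v164300j1 : (⟨0, 0, 0, -55000, -5021875⟩ : WeierstrassCurve ℚ).IsGloballyMinimal :=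
  isGloballyMinimal_of_krausCriterion₃_factored 0 0 0 (-55000) (-5021875) [(2, 4), (5, 10), (31, 3), (53, 1)] (by decide +kernel)
    (by intro qe hqe; fin_cases hqe <;> norm_num) (by decide +kernel)

/-- `6572b1` = `[0, 1, 0, -326, 2161]` (Cremona) has `Δ ≠ 0`. [cite: Cremona1997, Table 1 (label 6572b1)] -/
theorem isElliptic_c6572b1 : (⟨0, 1, 0, -326, 2161⟩ : WeierstrassCurve ℚ).IsElliptic :=
  isElliptic_of_discOf_ne_zero 0 1 0 (-326) 2161 (by decide +kernel)

-- `decide` evaluates `discOf`/`c4Of`/`c6Of` and the Kraus tests on the literal coefficients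
set_option maxRecDepth 100000 in
/-- `6572b1` = `[0, 1, 0, -326, 2161]` (Cremona) is globally minimal — Kraus' criterion, factored form `|Δ| = 2^4 · 31 · 53^2`, in the kernel.
[cite: Kraus1989, Prop. 1 and Prop. 2] [cite: SilvermanAEC2009, VII.1 Remark 1.1] [cite: Cremona1997, Table 1 (label 6572b1)] -/
theorem isGloballyMinimal_c6572b1 : (⟨0, 1, 0, -326, 2161⟩ : WeierstrassCurve ℚ).IsGloballyMinimal :=
  isGloballyMinimal_of_krausCriterion₃_factored 0 1 0 (-326) 2161 [(2, 4), (31, 1), (53, 2)] (by decide +kernel)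
    (by intro qe hqe; fin_cases hqe <;> norm_num) (by decide +kernel)

-- `decide` evaluates the schema point counts, the supports and the two root censuses on the literal coefficients
set_option maxRecDepth 100000 in
/-- **L₀ = `ord_5 #Ш_an ≤ ord_5 #Ш` for `164300j1`** (Cremona's minimal model `[0, 0, 0, -55000, -5021875]`, `N = 164300 = 25·6572`; additive
potentially supersingular TAME (t′) at `5`, Kodaira `II*` with `v₅(c₄) = 4` (cell `L_{II*,5}`); `r_an = 0`, `#Ш_an = 25` (`ord₅ = 2`),
`∏ c_ℓ = 1`, `#E(ℚ)_tors = 1`; census verdict `SEED-strict` tier B)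
**by the SeedRowC road from the partner `6572b1`** `[0, 1, 0, -326, 2161]` (rank `2`, good ORDINARY at `5`: `#G̃(𝔽₅) = 7`, `a₅ = -1`
— `a₅² ≡ 1 (mod 5)`: the Fouquet Thm 2.10 input is the Colmez–Wang PREPRINT on this row, flag `@Fouquet-2.10-via-ColmezWang-PRE`; `ρ̄_{G,5}` onto).
IN THE KERNEL: `Δ ≠ 0` and global minimality of both equations (Kraus, factored form: `|Δ_W| = 2^4 · 5^10 · 31^3 · 53`,
`|Δ_G| = 2^4 · 31 · 53^2`); `ρ̄_{W,5}` and `ρ̄_{G,5}` onto by Serre Prop. 19 witnesses at `ℓ = 13, 3, 3`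
(`#W̃ = 18, 1, 1`; `#G̃ = 18, 6, 6`); `GoodOrd G 5`; strict level compatibility (every prime of `Δ_G`
divides `Δ_W` or is `5`); Ass. 3.4 in Tate form for `W` (no multiplicative prime q with 5 ∣ v_q(Δ_min): vacuous); Ass. 2.9 (2) EXACTLY (`ΨSq_5`
rootless in `ℚ_5`) by the two Hensel root censuses `check₄ 5 prePsi5Z 2 [] ∧ check₄ 5 prePsi5Z.reverse 1 []`.
BINDERS: named facts (A′) `hA`, BCS Thm 1.1.2 (b) `hBCS`, modularity `hmodN`, GZK `hGZK`, Kraus–Oesterlé Prop. 4 `hKO`; the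
instances (proved below as `isElliptic_…` / `isGloballyMinimal_…`); Cremona's `r_an = 0` (`hr`); the FINITE K–O trace list `hlist`
(kit j265271, engines A = PARI `scan.gp` / B = `engineB.py` of kt-pdesc g2 VERBATIM: K–O modulus `M = 164300`, `S = []`, `μ(M) = 311040`, bound `ℓ ≤ 51839`: 5304 primes, engine A PASS = engine B PASS (PASS 51839 5304)). Per-row instance of `SeedRowC`; the
class-wide statement and the items stay OPEN; nothing booked; BSD is not proved for this curve by this file.
[cite: Fouquet2025EquivariantTNC, Thm 4.1 (1)⇒(2) (pp. 24–25), Ass. 2.9 (p. 15), Ass. 3.4 (pp. 22–23)] [cite: BurungaleCastellaSkinner2025, Thm 1.1.2 (b)]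
[cite: KrausOesterle1992, Prop. 4] [cite: Serre1972, §2.8 Prop. 19] [cite: Cremona1997, Table 1 (labels 164300j1, 6572b1)] [cite: Miller2011LMS, Def. 1.1] -/
theorem tameLower_bcs_v164300j1
    (hA : Fouquet2025.padicValRat_bsd_rank_zero_of_congruence_of_seedMainIdentity)
    (hBCS : burungale_castella_skinner_charIdeal_eq_padicLFunction_integral) (hmodN : exists_isNewformOf)
    (hGZK : rank_eq_analyticRank_of_analyticRank_le_one) (hKO : KrausOesterle1992.prop4_torsionIso_of_congruences)
    (W G : WeierstrassCurve ℚ) [W.IsElliptic] [W.IsGloballyMinimal] [G.IsElliptic] [G.IsGloballyMinimal]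
    (hW : W = ⟨0, 0, 0, -55000, -5021875⟩) (hG : G = ⟨0, 1, 0, -326, 2161⟩) (hr : W.analyticRank = 0)
    (hlist : ∀ (ℓ : ℕ) [Fact ℓ.Prime],
      6 * ℓ < KrausOesterle1992.gammaZeroIndex (KrausOesterle1992.modulus W G) →
      (padicValNat ℓ (W.conductorNorm ℤ * G.conductorNorm ℤ) = 0 →
          (5 : ℤ) ∣ W.frobeniusTrace ℓ - G.frobeniusTrace ℓ) ∧
        (padicValNat ℓ (W.conductorNorm ℤ * G.conductorNorm ℤ) = 1 →
          (5 : ℤ) ∣ W.frobeniusTrace ℓ * G.frobeniusTrace ℓ - (ℓ + 1))) :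
    MissingLowerBoundAt W 5 := by
  subst hW hG
  have hminW : (⟨0, 0, 0, -55000, -5021875⟩ : WeierstrassCurve ℚ).IsGloballyMinimal := inferInstance
  have hminG : (⟨0, 1, 0, -326, 2161⟩ : WeierstrassCurve ℚ).IsGloballyMinimal := inferInstance
  have hIW : integralModelInt (⟨0, 0, 0, -55000, -5021875⟩ : WeierstrassCurve ℚ) = (⟨0, 0, 0, -55000, -5021875⟩ : WeierstrassCurve ℤ) :=
    integralModelInt_eq_of_map_eq _ (map_mk_int 0 0 0 (-55000) (-5021875))
  have hIG : integralModelInt (⟨0, 1, 0, -326, 2161⟩ : WeierstrassCurve ℚ) = (⟨0, 1, 0, -326, 2161⟩ : WeierstrassCurve ℤ) :=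
    integralModelInt_eq_of_map_eq _ (map_mk_int 0 1 0 (-326) 2161)
  have hsurjW : Surj (⟨0, 0, 0, -55000, -5021875⟩ : WeierstrassCurve ℚ) 5 :=
    @surj_of_ainvs_of_serreWitnesses 0 0 0 (-55000) (-5021875) 5 ⟨by norm_num⟩ (by norm_num) hminW
      13 3 3 (by norm_num) (by norm_num) (by norm_num) (by decide) (by decide) (by decide)
      (by decide) (by decide) (by decide) (by decide +kernel) (by decide +kernel) (by decide +kernel)
      (n₁ := 18) (n₂ := 1) (n₃ := 1) (by decide +kernel) (by decide +kernel) (by decide +kernel)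
      (2 : ZMod 5) (3 : ZMod 5) (by decide +kernel) (by decide +kernel) (by decide +kernel)
  have hsurjG : Surj (⟨0, 1, 0, -326, 2161⟩ : WeierstrassCurve ℚ) 5 :=
    @surj_of_ainvs_of_serreWitnesses 0 1 0 (-326) 2161 5 ⟨by norm_num⟩ (by norm_num) hminG
      13 3 3 (by norm_num) (by norm_num) (by norm_num) (by decide) (by decide) (by decide)
      (by decide) (by decide) (by decide) (by decide +kernel) (by decide +kernel) (by decide +kernel)
      (n₁ := 18) (n₂ := 6) (n₃ := 6) (by decide +kernel) (by decide +kernel) (by decide +kernel)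
      (2 : ZMod 5) (3 : ZMod 5) (by decide +kernel) (by decide +kernel) (by decide +kernel)
  have hordG : GoodOrd (⟨0, 1, 0, -326, 2161⟩ : WeierstrassCurve ℚ) 5 :=
    @KTSeedRec.goodOrd_of_countPoints 0 1 0 (-326) 2161 5 ⟨by norm_num⟩ (by norm_num) hminG (by decide +kernel) 7
      (by decide +kernel) (by decide)
  have hlev : FouquetLevelCompatibleAt 5 (⟨0, 0, 0, -55000, -5021875⟩ : WeierstrassCurve ℚ) (⟨0, 1, 0, -326, 2161⟩ : WeierstrassCurve ℚ) :=
    @KTSeedRec.fouquetLevelCompatibleAt_of_factorList 5 ⟨by norm_num⟩ _ _ _ _ _ _ _ _ hIW hIG [(2, 4), (31, 1), (53, 2)]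
      (by intro qe hqe; fin_cases hqe <;> norm_num) (by rw [intCurve_Δ]; decide +kernel)
      (by simp only [intCurve_Δ]; decide +kernel)
  have h34 : Fouquet2025.Assumption34TateAt 5 (⟨0, 0, 0, -55000, -5021875⟩ : WeierstrassCurve ℚ) :=
    KTSeedRec.assumption34TateAt_of_factorList 5 hIW [(2, 4), (5, 10), (31, 3), (53, 1)]
      (by intro qe hqe; fin_cases hqe <;> norm_num) (by rw [intCurve_Δ]; decide +kernel)
      (by simp only [intCurve_Δ, intCurve_c₄]; decide +kernel)
  have hgen := KTSeedRec.fouquetGenericAt_five_of_rootCensus 0 0 0 (-55000) (-5021875) 2 1 (by decide +kernel)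
    (by decide +kernel)
  haveI : Fact (Nat.Prime 5) := ⟨by norm_num⟩
  exact missingLowerBoundAt_rankZero_of_bcsSeed_of_prop4 _ _ 5 hA hBCS hmodN hGZK hKO (by norm_num) hr hsurjW hgen h34
    hordG hsurjG hlev hlist

/-- `172550b1` = `[1, -1, 1, 950820, -793387803]` (Cremona) has `Δ ≠ 0`. [cite: Cremona1997, Table 1 (label 172550b1)] -/
theorem isElliptic_v172550b1 : (⟨1, -1, 1, 950820, -793387803⟩ : WeierstrassCurve ℚ).IsElliptic :=
  isElliptic_of_discOf_ne_zero 1 (-1) 1 950820 (-793387803) (by decide +kernel)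

-- `decide` evaluates `discOf`/`c4Of`/`c6Of` and the Kraus tests on the literal coefficients
set_option maxRecDepth 100000 in
/-- `172550b1` = `[1, -1, 1, 950820, -793387803]` (Cremona) is globally minimal — Kraus' criterion, factored form `|Δ| = 2 · 5^10 · 7^9 · 17 · 29^3`, in the kernel.
[cite: Kraus1989, Prop. 1 and Prop. 2] [cite: SilvermanAEC2009, VII.1 Remark 1.1] [cite: Cremona1997, Table 1 (label 172550b1)] -/
theorem isGloballyMinimal_v172550b1 : (⟨1, -1, 1, 950820, -793387803⟩ : WeierstrassCurve ℚ).IsGloballyMinimal :=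
  isGloballyMinimal_of_krausCriterion₃_factored 1 (-1) 1 950820 (-793387803) [(2, 1), (5, 10), (7, 9), (17, 1), (29, 3)] (by decide +kernel)
    (by intro qe hqe; fin_cases hqe <;> norm_num) (by decide +kernel)

/-- `6902c1` = `[1, -1, 1, -459, 16347]` (Cremona) has `Δ ≠ 0`. [cite: Cremona1997, Table 1 (label 6902c1)] -/
theorem isElliptic_c6902c1 : (⟨1, -1, 1, -459, 16347⟩ : WeierstrassCurve ℚ).IsElliptic :=
  isElliptic_of_discOf_ne_zero 1 (-1) 1 (-459) 16347 (by decide +kernel)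

-- `decide` evaluates `discOf`/`c4Of`/`c6Of` and the Kraus tests on the literal coefficients
set_option maxRecDepth 100000 in
/-- `6902c1` = `[1, -1, 1, -459, 16347]` (Cremona) is globally minimal — Kraus' criterion, factored form `|Δ| = 2^18 · 7^2 · 17^2 · 29`, in the kernel.
[cite: Kraus1989, Prop. 1 and Prop. 2] [cite: SilvermanAEC2009, VII.1 Remark 1.1] [cite: Cremona1997, Table 1 (label 6902c1)] -/
theorem isGloballyMinimal_c6902c1 : (⟨1, -1, 1, -459, 16347⟩ : WeierstrassCurve ℚ).IsGloballyMinimal :=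
  isGloballyMinimal_of_krausCriterion₃_factored 1 (-1) 1 (-459) 16347 [(2, 18), (7, 2), (17, 2), (29, 1)] (by decide +kernel)
    (by intro qe hqe; fin_cases hqe <;> norm_num) (by decide +kernel)

-- `decide` evaluates the schema point counts, the supports and the two root censuses on the literal coefficients
set_option maxRecDepth 100000 in
/-- **L₀ = `ord_5 #Ш_an ≤ ord_5 #Ш` for `172550b1`** (Cremona's minimal model `[1, -1, 1, 950820, -793387803]`, `N = 172550 = 25·6902`; additive
potentially supersingular TAME (t′) at `5`, Kodaira `II*` with `v₅(c₄) = 4` (cell `L_{II*,5}`); `r_an = 0`, `#Ш_an = 25` (`ord₅ = 2`),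
`∏ c_ℓ = 1`, `#E(ℚ)_tors = 1`; census verdict `SEED-strict` tier A)
**by the SeedRowC road from the partner `6902c1`** `[1, -1, 1, -459, 16347]` (rank `2`, good ORDINARY at `5`: `#G̃(𝔽₅) = 9`, `a₅ = -3`
— `a₅² ≢ 1 (mod 5)`: preprint-free chain, Nakamura 2023; `ρ̄_{G,5}` onto).
IN THE KERNEL: `Δ ≠ 0` and global minimality of both equations (Kraus, factored form: `|Δ_W| = 2 · 5^10 · 7^9 · 17 · 29^3`,
`|Δ_G| = 2^18 · 7^2 · 17^2 · 29`); `ρ̄_{W,5}` and `ρ̄_{G,5}` onto by Serre Prop. 19 witnesses at `ℓ = 23, 3, 3`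
(`#W̃ = 18, 7, 7`; `#G̃ = 28, 7, 7`); `GoodOrd G 5`; strict level compatibility (every prime of `Δ_G`
divides `Δ_W` or is `5`); Ass. 3.4 in Tate form for `W` (no multiplicative prime q with 5 ∣ v_q(Δ_min): vacuous); Ass. 2.9 (2) EXACTLY (`ΨSq_5`
rootless in `ℚ_5`) by the two Hensel root censuses `check₄ 5 prePsi5Z 2 [] ∧ check₄ 5 prePsi5Z.reverse 2 []`.
BINDERS: named facts (A′) `hA`, BCS Thm 1.1.2 (b) `hBCS`, modularity `hmodN`, GZK `hGZK`, Kraus–Oesterlé Prop. 4 `hKO`; the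
instances (proved below as `isElliptic_…` / `isGloballyMinimal_…`); Cremona's `r_an = 0` (`hr`); the FINITE K–O trace list `hlist`
(kit j265273, engines A = PARI `scan.gp` / B = `engineB.py` of kt-pdesc g2 VERBATIM: K–O modulus `M = 172550`, `S = []`, `μ(M) = 388800`, bound `ℓ ≤ 64799`: 6477 primes, engine A PASS = engine B PASS (PASS 64799 6477)). Per-row instance of `SeedRowC`; the
class-wide statement and the items stay OPEN; nothing booked; BSD is not proved for this curve by this file.
[cite: Fouquet2025EquivariantTNC, Thm 4.1 (1)⇒(2) (pp. 24–25), Ass. 2.9 (p. 15), Ass. 3.4 (pp. 22–23)] [cite: BurungaleCastellaSkinner2025, Thm 1.1.2 (b)]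
[cite: KrausOesterle1992, Prop. 4] [cite: Serre1972, §2.8 Prop. 19] [cite: Cremona1997, Table 1 (labels 172550b1, 6902c1)] [cite: Miller2011LMS, Def. 1.1] -/
theorem tameLower_bcs_v172550b1
    (hA : Fouquet2025.padicValRat_bsd_rank_zero_of_congruence_of_seedMainIdentity)
    (hBCS : burungale_castella_skinner_charIdeal_eq_padicLFunction_integral) (hmodN : exists_isNewformOf)
    (hGZK : rank_eq_analyticRank_of_analyticRank_le_one) (hKO : KrausOesterle1992.prop4_torsionIso_of_congruences)
    (W G : WeierstrassCurve ℚ) [W.IsElliptic] [W.IsGloballyMinimal] [G.IsElliptic] [G.IsGloballyMinimal]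
    (hW : W = ⟨1, -1, 1, 950820, -793387803⟩) (hG : G = ⟨1, -1, 1, -459, 16347⟩) (hr : W.analyticRank = 0)
    (hlist : ∀ (ℓ : ℕ) [Fact ℓ.Prime],
      6 * ℓ < KrausOesterle1992.gammaZeroIndex (KrausOesterle1992.modulus W G) →
      (padicValNat ℓ (W.conductorNorm ℤ * G.conductorNorm ℤ) = 0 →
          (5 : ℤ) ∣ W.frobeniusTrace ℓ - G.frobeniusTrace ℓ) ∧
        (padicValNat ℓ (W.conductorNorm ℤ * G.conductorNorm ℤ) = 1 →
          (5 : ℤ) ∣ W.frobeniusTrace ℓ * G.frobeniusTrace ℓ - (ℓ + 1))) :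
    MissingLowerBoundAt W 5 := by
  subst hW hG
  have hminW : (⟨1, -1, 1, 950820, -793387803⟩ : WeierstrassCurve ℚ).IsGloballyMinimal := inferInstance
  have hminG : (⟨1, -1, 1, -459, 16347⟩ : WeierstrassCurve ℚ).IsGloballyMinimal := inferInstance
  have hIW : integralModelInt (⟨1, -1, 1, 950820, -793387803⟩ : WeierstrassCurve ℚ) = (⟨1, -1, 1, 950820, -793387803⟩ : WeierstrassCurve ℤ) :=
    integralModelInt_eq_of_map_eq _ (map_mk_int 1 (-1) 1 950820 (-793387803))
  have hIG : integralModelInt (⟨1, -1, 1, -459, 16347⟩ : WeierstrassCurve ℚ) = (⟨1, -1, 1, -459, 16347⟩ : WeierstrassCurve ℤ) :=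
    integralModelInt_eq_of_map_eq _ (map_mk_int 1 (-1) 1 (-459) 16347)
  have hsurjW : Surj (⟨1, -1, 1, 950820, -793387803⟩ : WeierstrassCurve ℚ) 5 :=
    @surj_of_ainvs_of_serreWitnesses 1 (-1) 1 950820 (-793387803) 5 ⟨by norm_num⟩ (by norm_num) hminW
      23 3 3 (by norm_num) (by norm_num) (by norm_num) (by decide) (by decide) (by decide)
      (by decide) (by decide) (by decide) (by decide +kernel) (by decide +kernel) (by decide +kernel)
      (n₁ := 18) (n₂ := 7) (n₃ := 7) (by decide +kernel) (by decide +kernel) (by decide +kernel)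
      (2 : ZMod 5) (3 : ZMod 5) (by decide +kernel) (by decide +kernel) (by decide +kernel)
  have hsurjG : Surj (⟨1, -1, 1, -459, 16347⟩ : WeierstrassCurve ℚ) 5 :=
    @surj_of_ainvs_of_serreWitnesses 1 (-1) 1 (-459) 16347 5 ⟨by norm_num⟩ (by norm_num) hminG
      23 3 3 (by norm_num) (by norm_num) (by norm_num) (by decide) (by decide) (by decide)
      (by decide) (by decide) (by decide) (by decide +kernel) (by decide +kernel) (by decide +kernel)
      (n₁ := 28) (n₂ := 7) (n₃ := 7) (by decide +kernel) (by decide +kernel) (by decide +kernel)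
      (2 : ZMod 5) (3 : ZMod 5) (by decide +kernel) (by decide +kernel) (by decide +kernel)
  have hordG : GoodOrd (⟨1, -1, 1, -459, 16347⟩ : WeierstrassCurve ℚ) 5 :=
    @KTSeedRec.goodOrd_of_countPoints 1 (-1) 1 (-459) 16347 5 ⟨by norm_num⟩ (by norm_num) hminG (by decide +kernel) 9
      (by decide +kernel) (by decide)
  have hlev : FouquetLevelCompatibleAt 5 (⟨1, -1, 1, 950820, -793387803⟩ : WeierstrassCurve ℚ) (⟨1, -1, 1, -459, 16347⟩ : WeierstrassCurve ℚ) :=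
    @KTSeedRec.fouquetLevelCompatibleAt_of_factorList 5 ⟨by norm_num⟩ _ _ _ _ _ _ _ _ hIW hIG [(2, 18), (7, 2), (17, 2), (29, 1)]
      (by intro qe hqe; fin_cases hqe <;> norm_num) (by rw [intCurve_Δ]; decide +kernel)
      (by simp only [intCurve_Δ]; decide +kernel)
  have h34 : Fouquet2025.Assumption34TateAt 5 (⟨1, -1, 1, 950820, -793387803⟩ : WeierstrassCurve ℚ) :=
    KTSeedRec.assumption34TateAt_of_factorList 5 hIW [(2, 1), (5, 10), (7, 9), (17, 1), (29, 3)]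
      (by intro qe hqe; fin_cases hqe <;> norm_num) (by rw [intCurve_Δ]; decide +kernel)
      (by simp only [intCurve_Δ, intCurve_c₄]; decide +kernel)
  have hgen := KTSeedRec.fouquetGenericAt_five_of_rootCensus 1 (-1) 1 950820 (-793387803) 2 2 (by decide +kernel)
    (by decide +kernel)
  haveI : Fact (Nat.Prime 5) := ⟨by norm_num⟩
  exact missingLowerBoundAt_rankZero_of_bcsSeed_of_prop4 _ _ 5 hA hBCS hmodN hGZK hKO (by norm_num) hr hsurjW hgen h34
    hordG hsurjG hlev hlist

end Summit.BirchSwinnertonDyer.BirchSwinnertonDyer.Theorems.KTSeedRowC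

end
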